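import Mathlib
import Summits.Ventures.PercRepro2.CutVertexPieceCCC

/-!
# The cut vertex separating the roots, VI: the pieces `BBC` and `BBD` (blind cell PercRepro2, p3 g2,
2026-08-25; `proofs/P3-BRIDGE.md` §10.9)

`Wsym B B C = 4 P(Q) · [P(o, b ∈ C(a₁)) − P(o ∈ C(a₁)) P(b ∈ C(a₁))] ≥ 0` (Harris; `Q = {a₁ ↮ c}`):
the ordered kernels are `Kt B B C = 0`, `Kt B C B = −q(y)(o₁ + o_c)(y) b₁(z)`,
`Kt C B B = q(x)[2(o₁b₁)(z) − 2 b₁(y) o₁(z) + (o₁ + o_c)(x) b₁(y)]`, and the `(o₁ + o_c)` terms cancel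
between the two orderings.  Own work; standard axioms.
-/

namespace Summit.Ventures.PercRepro2

open UnionCluster

namespace CovForm

namespace RootBridge

open OneTyped

section PieceBBC

open Classical

variable {V : Type*} {E : Type*} [Fintype E] [DecidableEq E] [Fintype V] [DecidableEq V] {R : Type*}
  [Field R] [LinearOrder R] [IsStrictOrderedRing R]
variable (p : E → R) (ends : E → Sym2 V) (o a₁ a₂ a₃ b c : V) (VL VH : Set V)

omit [Fintype E] [DecidableEq E] [Fintype V] [DecidableEq V] [LinearOrder R] [IsStrictOrderedRing R] in
/-- `Kt B B C = 0`. -/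
lemma Kt_BBC (l₁ l₂ l₃ : LSt) : (Kt HState.B HState.B HState.C l₁ l₂ l₃ : R) = 0 := by
  simp [Kt, KB, gluedSt, qB, pdB, sigB, uB, St.q', St.Lo, St.Ho, St.Lb, St.Hb, St.L3, St.H3,
    HState.hv, HState.h3, HState.v3, LSt.al, LSt.o1, LSt.b1, LSt.oc, LSt.bc]

omit [Fintype E] [DecidableEq E] [Fintype V] [DecidableEq V] [LinearOrder R] [IsStrictOrderedRing R] in
/-- `Kt B C B = −q(y)(o₁ + o_c)(y) b₁(z)`. -/
lemma Kt_BCB (l₁ l₂ l₃ : LSt) : (Kt HState.B HState.C HState.B l₁ l₂ l₃ : R) =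
    -((if l₂.1 then (0 : R) else 1) * ((if l₂.2.1 then (1 : R) else 0) + (if l₂.2.2.2.1 then (1 : R) else 0)) *
      (if l₃.2.2.1 then (1 : R) else 0)) := by
  simp [Kt, KB, gluedSt, qB, pdB, sigB, uB, St.q', St.Lo, St.Ho, St.Lb, St.Hb, St.L3, St.H3,
    HState.hv, HState.h3, HState.v3, LSt.al, LSt.o1, LSt.b1, LSt.oc, LSt.bc]
  split_ifs <;> ring

omit [Fintype E] [DecidableEq E] [Fintype V] [DecidableEq V] [LinearOrder R] [IsStrictOrderedRing R] in
/-- `Kt C B B = q(x)[2(o₁b₁)(z) − 2 b₁(y) o₁(z) + (o₁ + o_c)(x) b₁(y)]`. -/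
lemma Kt_CBB (l₁ l₂ l₃ : LSt) : (Kt HState.C HState.B HState.B l₁ l₂ l₃ : R) =
    (if l₁.1 then (0 : R) else 1) *
      (2 * ((if l₃.2.1 then (1 : R) else 0) * (if l₃.2.2.1 then (1 : R) else 0)) -
        2 * ((if l₂.2.2.1 then (1 : R) else 0) * (if l₃.2.1 then (1 : R) else 0)) +
        ((if l₁.2.1 then (1 : R) else 0) + (if l₁.2.2.2.1 then (1 : R) else 0)) *
          (if l₂.2.2.1 then (1 : R) else 0)) := by
  simp [Kt, KB, gluedSt, qB, pdB, sigB, uB, St.q', St.Lo, St.Ho, St.Lb, St.Hb, St.L3, St.H3,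
    HState.hv, HState.h3, HState.v3, LSt.al, LSt.o1, LSt.b1, LSt.oc, LSt.bc]
  split_ifs <;> ring

omit [Fintype V] [DecidableEq V] [LinearOrder R] [IsStrictOrderedRing R] in
/-- `Wt B B C = 0`. -/
lemma Wt_BBC_eq : Wt p ends o a₁ b c VL HState.B HState.B HState.C = 0 := by
  unfold Wt
  simp [Kt_BBC]

omit [Fintype V] [DecidableEq V] [LinearOrder R] [IsStrictOrderedRing R] in
/-- `Wt B C B = −[P(Q, o ∈ C(a₁)) + P(Q, o ∈ C(c))] · P(b ∈ C(a₁))`. -/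
lemma Wt_BCB_eq {VL VH : Set V} (h : CutVertex ends o a₁ a₂ a₃ b c VL VH) :
    Wt p ends o a₁ b c VL HState.B HState.C HState.B =
      -((prob p (avoidAll ends a₁ {c} ∩ connEvent ends a₁ o) +
          prob p (avoidAll ends a₁ {c} ∩ connEvent ends c o)) * prob p (connEvent ends a₁ b)) := by
  unfold Wt
  set I : Config E → R := iQc ends a₁ c with hI
  have e : ∀ x y z : Config E, weight p x * weight p y * weight p z *
      Kt HState.B HState.C HState.B (lstC ends o a₁ b c VL x) (lstC ends o a₁ b c VL y)
        (lstC ends o a₁ b c VL z) =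
      -(weight p x * weight p y * weight p z *
        ((fun _ => (1 : R)) x * ((I y * iL ends a₁ o y) * iL ends a₁ b z))) -
      weight p x * weight p y * weight p z *
        ((fun _ => (1 : R)) x * ((I y * iL ends c o y) * iL ends a₁ b z)) := by
    intro x y z
    rw [Kt_BCB, lst_q_eq ends o a₁ a₂ a₃ b c h y, lst_o1_eq ends o a₁ a₂ a₃ b c h y,
      lst_oc_eq ends o a₁ a₂ a₃ b c h y, lst_b1_eq ends o a₁ a₂ a₃ b c h z]
    ring
  simp only [e, Finset.sum_sub_distrib, Finset.sum_neg_distrib]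
  rw [triple_sum_sep, triple_sum_sep]
  have h1 : (fun y => I y * iL ends a₁ o y) =
      (avoidAll ends a₁ {c} ∩ connEvent ends a₁ o).indicator (1 : Config E → R) := by
    funext y; rw [hI]; unfold iQc iL; rw [indicator_inter_one]
  have h2 : (fun y => I y * iL ends c o y) =
      (avoidAll ends a₁ {c} ∩ connEvent ends c o).indicator (1 : Config E → R) := by
    funext y; rw [hI]; unfold iQc iL; rw [indicator_inter_one]
  rw [h1, h2]
  simp only [expect_const, prob_eq_expect_indicator]
  unfold iL
  ring

omit [Fintype V] [DecidableEq V] [LinearOrder R] [IsStrictOrderedRing R] in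
/-- `Wt C B B = 2 P(Q)[P(o, b ∈ C(a₁)) − P(b ∈ C(a₁)) P(o ∈ C(a₁))] + [P(Q, o ∈ C(a₁)) + P(Q, o ∈ C(c))] P(b ∈ C(a₁))`. -/
lemma Wt_CBB_eq {VL VH : Set V} (h : CutVertex ends o a₁ a₂ a₃ b c VL VH) :
    Wt p ends o a₁ b c VL HState.C HState.B HState.B =
      2 * prob p (avoidAll ends a₁ {c}) *
          (prob p (connEvent ends a₁ o ∩ connEvent ends a₁ b) -
            prob p (connEvent ends a₁ b) * prob p (connEvent ends a₁ o)) +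
        (prob p (avoidAll ends a₁ {c} ∩ connEvent ends a₁ o) +
          prob p (avoidAll ends a₁ {c} ∩ connEvent ends c o)) * prob p (connEvent ends a₁ b) := by
  unfold Wt
  set I : Config E → R := iQc ends a₁ c with hI
  have e : ∀ x y z : Config E, weight p x * weight p y * weight p z *
      Kt HState.C HState.B HState.B (lstC ends o a₁ b c VL x) (lstC ends o a₁ b c VL y)
        (lstC ends o a₁ b c VL z) =
      weight p x * weight p y * weight p z *
        ((fun x => 2 * I x) x * ((fun _ => (1 : R)) y * (iL ends a₁ o z * iL ends a₁ b z))) -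
      weight p x * weight p y * weight p z *
        ((fun x => 2 * I x) x * (iL ends a₁ b y * iL ends a₁ o z)) +
      weight p x * weight p y * weight p z *
        ((I x * iL ends a₁ o x) * (iL ends a₁ b y * (fun _ => (1 : R)) z)) +
      weight p x * weight p y * weight p z *
        ((I x * iL ends c o x) * (iL ends a₁ b y * (fun _ => (1 : R)) z)) := by
    intro x y z
    rw [Kt_CBB, lst_q_eq ends o a₁ a₂ a₃ b c h x, lst_o1_eq ends o a₁ a₂ a₃ b c h x,
      lst_oc_eq ends o a₁ a₂ a₃ b c h x, lst_b1_eq ends o a₁ a₂ a₃ b c h y,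
      lst_o1_eq ends o a₁ a₂ a₃ b c h z, lst_b1_eq ends o a₁ a₂ a₃ b c h z]
    ring
  simp only [e, Finset.sum_add_distrib, Finset.sum_sub_distrib]
  rw [triple_sum_sep, triple_sum_sep, triple_sum_sep, triple_sum_sep]
  have h0 : expect p (fun x => 2 * I x) = 2 * expect p I := expect_const_mul p 2 I
  have h1 : (fun x => I x * iL ends a₁ o x) =
      (avoidAll ends a₁ {c} ∩ connEvent ends a₁ o).indicator (1 : Config E → R) := by
    funext x; rw [hI]; unfold iQc iL; rw [indicator_inter_one]
  have h2 : (fun x => I x * iL ends c o x) =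
      (avoidAll ends a₁ {c} ∩ connEvent ends c o).indicator (1 : Config E → R) := by
    funext x; rw [hI]; unfold iQc iL; rw [indicator_inter_one]
  have h3 : (fun z => iL ends a₁ o z * iL ends a₁ b z) =
      (connEvent ends a₁ o ∩ connEvent ends a₁ b).indicator (1 : Config E → R) := by
    funext z; unfold iL; rw [indicator_inter_one]
  rw [h0, h1, h2, h3]
  simp only [expect_const, prob_eq_expect_indicator]
  rw [hI]
  unfold iQc iL
  ring

omit [Fintype V] [DecidableEq V] in
/-- **The symmetrised piece `{B, B, C}` is `4 P(Q) · Harris(o₁, b₁) ≥ 0`.** -/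
theorem Wsym_BBC_nonneg (hp : IsProbVec p) {VL VH : Set V}
    (h : CutVertex ends o a₁ a₂ a₃ b c VL VH) :
    0 ≤ Wsym p ends o a₁ b c VL HState.B HState.B HState.C := by
  unfold Wsym
  rw [Wt_BBC_eq, Wt_BCB_eq p ends o a₁ a₂ a₃ b c h, Wt_CBB_eq p ends o a₁ a₂ a₃ b c h]
  have hQ := prob_nonneg hp (avoidAll ends a₁ {c})
  have hh := prob_mul_prob_le_prob_inter hp (isUpperSet_connEvent ends a₁ o)
    (isUpperSet_connEvent ends a₁ b)
  nlinarith [hh, hQ, mul_nonneg hQ (sub_nonneg.2 hh)]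

end PieceBBC

end RootBridge

end CovForm

end Summit.Ventures.PercRepro2
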